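import Summits.KontsevichZagierPeriods.KontsevichZagierPeriods.Theorems.UnfoldedStokesStokesGenerationFibrewiseRungScalingSwaps
import Summits.KontsevichZagierPeriods.KontsevichZagierPeriods.Theorems.UnfoldedStokesStokesGenerationFibrewiseClosureCongr

/-!
# `StokesGeneration` (stmt-KontsevichZagierPeriods-3586) — line `fibrewise_stokes`, stub `stub_inversionLoopCertificate`

Registered rung stub HC (rung 28, the INVERSION RELATION of the dilogarithm
`Li₂(−x) + Li₂(−1/x) + ½ log² x = −π²/6` for `x > 0`, wave 7) of the line `fibrewise_stokes` of the crux
`StokesGeneration` (route UnfoldedStokes): **the parametric three-term dlog loop certificate of the inversion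
relation**. On the closed cube `[0,1]³` (`s = x 0` the loop variable, `y = x 1` the homotopy variable, `v = x 2`
a silent parameter), for positive real algebraic `x₁`, `x₂`, the affine path `X = X(v) = x₁ + (x₂ − x₁) v > 0`
and a continuous `ℚ`-semialgebraic coefficient `γ(v)`, the function
`γ(v) · [−1/(1 + X s) + 1/(X (X + s)) + (X − 1)/(X (1 + (X − 1) s))]`
is fibrewise-Stokes decomposable (`FibStokesDecomposable 3`, `Theorems/UnfoldedStokesDefs.lean`).

Proof. `X` times the bracket is the logarithmic `s`-derivative `P_s/P = 1/(X + s) + (X − 1)/(1 + (X − 1)s) − X/(1 + Xs)`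
of the loop `P(s, v) = (X + s)(1 + (X − 1)s)/(X (1 + X s))`, which is positive on the cube (`X + s > 0`,
`1 + (X − 1)s = (1 − s) + X s > 0`, `X (1 + X s) > 0`) and satisfies `P(0, v) = P(1, v) = 1`. Exactly as in rung 2
(`stub_rungCertificate`) and rung 19 (`stub_hillRelationA`), with the coefficient `γ̃(v) = γ(v)/X(v)`, `P' = P · X ·
[bracket]` and the homotopy `E = 1 + (P − 1)y > 0`, the primitives `G₀ = γ̃ (P − 1)/E` (direction `0`) and
`G₁ = γ̃ y P' (1/P − 1/E)` (direction `1`) have fibre derivatives `D₀ = γ̃ P'/E²`, `D₁ = γ̃ P'(1/P − 1/E²)` with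
`D₀ + D₁ = γ̃ P'/P = γ · [bracket]`, and all four face values `G₀|_{s=1}`, `G₀|_{s=0}`, `G₁|_{y=1}`, `G₁|_{y=0}`
vanish on the cube. The two elements are carried by closed-cube representations of the continuous
`ℚ`-semialgebraic `Dⱼ` (`exists_cubeRep`), the family is decomposable (`fibStokesDecomposable_of_elements`), and
`fibStokesDecomposable_congr_off_null` with the empty null set rewrites its sum as `γ · [bracket]`.

References: D. Zagier, *The dilogarithm function* (2007), §I.2 (the inversion relation); J. Ayoub, *Une version
relative de la conjecture des périodes de Kontsevich–Zagier*, Ann. of Math. 181 (2015), Rem. 1.5; M. Kontsevich,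
D. Zagier, *Periods* (2001), §1.2.
-/

noncomputable section

-- `Summit.KontsevichZagierPeriods.KontsevichZagierPeriods.…` is the tree's mandated layout (single-conjunct summit).
set_option linter.dupNamespace false

namespace Summit.KontsevichZagierPeriods.KontsevichZagierPeriods.Cruxes.StokesGeneration.FibrewiseStokes

open MeasureTheory Set
open Literature.NumberTheory.Transcendental
open Literature.NumberTheory.Transcendental.KZ
open Literature.ModelTheory.ExponentialFields (IsSemialgebraic)

/-- The affine path `x₁ + (x₂ − x₁) v` between two positive reals is positive for `v ∈ [0,1]`. [folklore] -/
private theorem invLoop_affine_pos {x₁ x₂ : ℝ} (h₁0 : 0 < x₁) (h₂0 : 0 < x₂) {v : ℝ} (hv : v ∈ Set.Icc (0:ℝ) 1) :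
    0 < x₁ + (x₂ - x₁) * v := by
  rcases le_total x₁ x₂ with h | h
  · nlinarith [mul_nonneg hv.1 (sub_nonneg.2 h)]
  · nlinarith [mul_nonneg (sub_nonneg.2 hv.2) (sub_nonneg.2 h)]

/-- For `X > 0` and `s ∈ [0,1]`, `1 + (X − 1)s = (1 − s) + X s > 0`. [folklore] -/
private theorem invLoop_den_pos {X : ℝ} (hX : 0 < X) {s : ℝ} (hs : s ∈ Set.Icc (0:ℝ) 1) : 0 < 1 + (X - 1) * s := by
  rcases le_total 1 X with h | h
  · nlinarith [mul_nonneg (sub_nonneg.2 h) hs.1]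
  · nlinarith [mul_nonneg (sub_nonneg.2 h) (sub_nonneg.2 hs.2)]

/-- The `s`-derivative of the loop `P(s) = (X + s)(1 + (X − 1)s)/(X (1 + X s))` in logarithmic form:
`P' = P · X · [−1/(1 + Xs) + 1/(X(X + s)) + (X − 1)/(X(1 + (X − 1)s))]` wherever no factor vanishes. [folklore] -/
private theorem invLoop_hasDerivAt_loop {X s : ℝ} (hX : X ≠ 0) (hA : 1 + X * s ≠ 0) (hB : X + s ≠ 0)
    (hD : 1 + (X - 1) * s ≠ 0) :
    HasDerivAt (fun u => (X + u) * (1 + (X - 1) * u) / (X * (1 + X * u)))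
      ((X + s) * (1 + (X - 1) * s) / (X * (1 + X * s)) *
        (X * (-1 / (1 + X * s) + 1 / (X * (X + s)) + (X - 1) / (X * (1 + (X - 1) * s))))) s := by
  have hN : HasDerivAt (fun u => (X + u) * (1 + (X - 1) * u))
      (1 * (1 + (X - 1) * s) + (X + s) * ((X - 1) * 1)) s :=
    ((hasDerivAt_id' s).const_add X).fun_mul (((hasDerivAt_id' s).const_mul (X - 1)).const_add 1)
  have hM : HasDerivAt (fun u => X * (1 + X * u)) (X * (X * 1)) s :=
    (((hasDerivAt_id' s).const_mul X).const_add 1).const_mul X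
  refine (hN.fun_div hM (mul_ne_zero hX hA)).congr_deriv ?_
  field_simp
  ring

/-- **Registered stub `stub_inversionLoopCertificate` (rung 28, HC): the parametric three-term dlog loop certificate
of the inversion relation.** On `[0,1]³` (`s = x 0`, `y = x 1`, `v = x 2`), for positive real algebraic `x₁`, `x₂`,
`X = x₁ + (x₂ − x₁)v`, and a continuous `ℚ`-semialgebraic coefficient `γ(v)`,
`γ(v) · [−1/(1 + Xs) + 1/(X(X + s)) + (X − 1)/(X(1 + (X − 1)s))] ∈ Dec`: `X` times the bracket is `P_s/P` for the
loop `P = (X + s)(1 + (X − 1)s)/(X(1 + Xs))` (`P(0) = P(1) = 1`, `P > 0`), and the two elements `E_s[γ̃(P − 1)/E]`,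
`E_y[γ̃ y P_s (1/P − 1/E)]`, `γ̃ = γ/X`, `E = 1 + (P − 1)y`, certify it (all four faces vanish).
[cite: Zagier2007Dilogarithm, §I.2] -/
theorem stub_inversionLoopCertificate (x₁ x₂ : ℝ) (h₁ : IsAlgebraic ℚ x₁) (h₂ : IsAlgebraic ℚ x₂)
    (h₁0 : 0 < x₁) (h₂0 : 0 < x₂) (γ : ℝ → ℝ)
    (hγ : IsSemialgebraicFunOn ℚ (Set.pi Set.univ (fun _ : Fin 1 => Set.Icc (0:ℝ) 1)) (fun z => γ (z 0)))
    (hγc : ContinuousOn γ (Set.Icc (0:ℝ) 1)) :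
    FibStokesDecomposable 3 (fun x => γ (x 2) *
      (-1 / (1 + (x₁ + (x₂ - x₁) * x 2) * x 0) +
        1 / ((x₁ + (x₂ - x₁) * x 2) * ((x₁ + (x₂ - x₁) * x 2) + x 0)) +
        ((x₁ + (x₂ - x₁) * x 2) - 1) / ((x₁ + (x₂ - x₁) * x 2) * (1 + ((x₁ + (x₂ - x₁) * x 2) - 1) * x 0)))) := by
  classical
  set C : Set (Fin 3 → ℝ) := Set.pi Set.univ (fun _ : Fin 3 => Set.Icc (0:ℝ) 1) with hC
  have hCsa : IsSemialgebraic ℚ C := by rw [hC, ← cube_eq_pi]; exact isSemialgebraic_cube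
  have hCc : IsCompact C := isCompact_univ_pi fun _ => isCompact_Icc
  have hmem : ∀ x ∈ C, ∀ i, x i ∈ Set.Icc (0:ℝ) 1 := fun x hx i => (Set.mem_univ_pi.mp hx) i
  have hupd : ∀ x ∈ C, ∀ (i : Fin 3), ∀ s ∈ Set.Icc (0:ℝ) 1, Function.update x i s ∈ C :=
    fun x hx i s hs => update_mem_cubePi hx i hs
  have h10 : (1 : Fin 3) ≠ 0 := by decide
  have h20 : (2 : Fin 3) ≠ 0 := by decide
  have h01 : (0 : Fin 3) ≠ 1 := by decide
  have h21 : (2 : Fin 3) ≠ 1 := by decide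
  -- the affine path `X(v)` and positivity of the denominators on the closed cube
  set Xf : (Fin 3 → ℝ) → ℝ := fun x => x₁ + (x₂ - x₁) * x 2 with hXf
  have hX : ∀ x ∈ C, 0 < Xf x := fun x hx => invLoop_affine_pos h₁0 h₂0 (hmem x hx 2)
  have hXne : ∀ x ∈ C, Xf x ≠ 0 := fun x hx => (hX x hx).ne'
  have hA : ∀ x ∈ C, 0 < 1 + Xf x * x 0 := fun x hx => by
    have := mul_nonneg (hX x hx).le (hmem x hx 0).1
    linarith
  have hB : ∀ x ∈ C, 0 < Xf x + x 0 := fun x hx => by linarith [hX x hx, (hmem x hx 0).1]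
  have hD : ∀ x ∈ C, 0 < 1 + (Xf x - 1) * x 0 := fun x hx => invLoop_den_pos (hX x hx) (hmem x hx 0)
  have hAne : ∀ x ∈ C, 1 + Xf x * x 0 ≠ 0 := fun x hx => (hA x hx).ne'
  have hDne : ∀ x ∈ C, 1 + (Xf x - 1) * x 0 ≠ 0 := fun x hx => (hD x hx).ne'
  have hXAne : ∀ x ∈ C, Xf x * (1 + Xf x * x 0) ≠ 0 := fun x hx => mul_ne_zero (hXne x hx) (hAne x hx)
  have hXBne : ∀ x ∈ C, Xf x * (Xf x + x 0) ≠ 0 := fun x hx => mul_ne_zero (hXne x hx) (hB x hx).ne'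
  have hXDne : ∀ x ∈ C, Xf x * (1 + (Xf x - 1) * x 0) ≠ 0 := fun x hx => mul_ne_zero (hXne x hx) (hDne x hx)
  -- the loop `P`, the registered bracket `L` (`P' = P · X · L`), the coefficient `γ̃ = γ/X`, `E = 1 + (P − 1) y`
  set P : (Fin 3 → ℝ) → ℝ := fun x =>
    (Xf x + x 0) * (1 + (Xf x - 1) * x 0) / (Xf x * (1 + Xf x * x 0)) with hP
  set L : (Fin 3 → ℝ) → ℝ := fun x =>
    -1 / (1 + Xf x * x 0) + 1 / (Xf x * (Xf x + x 0)) + (Xf x - 1) / (Xf x * (1 + (Xf x - 1) * x 0)) with hL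
  set P' : (Fin 3 → ℝ) → ℝ := fun x => P x * (Xf x * L x) with hP'
  set γt : (Fin 3 → ℝ) → ℝ := fun x => γ (x 2) / Xf x with hγt
  set E : (Fin 3 → ℝ) → ℝ := fun x => 1 + (P x - 1) * x 1 with hE
  have hPpos : ∀ x ∈ C, 0 < P x := fun x hx =>
    div_pos (mul_pos (hB x hx) (hD x hx)) (mul_pos (hX x hx) (hA x hx))
  have hPne : ∀ x ∈ C, P x ≠ 0 := fun x hx => (hPpos x hx).ne'
  have hEpos : ∀ x ∈ C, 0 < E x := by
    intro x hx
    obtain ⟨h1l, h1u⟩ := hmem x hx 1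
    have hp := hPpos x hx
    show 0 < 1 + (P x - 1) * x 1
    rcases le_total 1 (P x) with h | h
    · nlinarith [mul_nonneg (sub_nonneg.2 h) h1l]
    · nlinarith [mul_nonneg (sub_nonneg.2 h) (sub_nonneg.2 h1u)]
  have hEne : ∀ x ∈ C, E x ≠ 0 := fun x hx => (hEpos x hx).ne'
  have hE2ne : ∀ x ∈ C, E x ^ 2 ≠ 0 := fun x hx => pow_ne_zero 2 (hEne x hx)
  -- `P = 1` on the faces `s = 0`, `s = 1`; `P`, `L`, `X`, `γ̃` do not depend on `y`; `X`, `γ̃` not on `s`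
  have hX0 : ∀ x s, Xf (Function.update x 0 s) = Xf x ∧ γt (Function.update x 0 s) = γt x := fun x s => by
    simp only [hXf, hγt, Function.update_of_ne h20, and_self]
  have hP00 : ∀ x ∈ C, P (Function.update x 0 0) = 1 := fun x hx => by
    simp only [hP, (hX0 x 0).1, Function.update_self, mul_zero, add_zero, mul_one]
    exact div_self (hXne x hx)
  have hP01 : ∀ x ∈ C, P (Function.update x 0 1) = 1 := fun x hx => by
    have hden : Xf x * (1 + Xf x * 1) ≠ 0 := by
      rw [mul_one]; exact mul_ne_zero (hXne x hx) (by linarith [hX x hx])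
    simp only [hP, (hX0 x 1).1, Function.update_self]
    rw [div_eq_one_iff_eq hden]
    ring
  have hPL1 : ∀ x s, P (Function.update x 1 s) = P x ∧ L (Function.update x 1 s) = L x ∧
      Xf (Function.update x 1 s) = Xf x ∧ γt (Function.update x 1 s) = γt x := fun x s => by
    simp only [hP, hL, hXf, hγt, Function.update_of_ne h01, Function.update_of_ne h21, and_self]
  -- semialgebraic atoms and closure under field operations (BCR Prop. 2.2.6)
  have hx0 : IsSemialgebraicFunOn ℚ C (fun x => x 0) := isSemialgebraicFunOn_apply hCsa 0
  have hx1 : IsSemialgebraicFunOn ℚ C (fun x => x 1) := isSemialgebraicFunOn_apply hCsa 1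
  have hx2 : IsSemialgebraicFunOn ℚ C (fun x => x 2) := isSemialgebraicFunOn_apply hCsa 2
  have hc₁ : IsSemialgebraicFunOn ℚ C (fun _ => x₁) := isSemialgebraicFunOn_const_of_isAlgebraic hCsa h₁
  have hc₂ : IsSemialgebraicFunOn ℚ C (fun _ => x₂) := isSemialgebraicFunOn_const_of_isAlgebraic hCsa h₂
  have hc1 : IsSemialgebraicFunOn ℚ C (fun _ => (1:ℝ)) := isSemialgebraicFunOn_const_of_isAlgebraic hCsa isAlgebraic_one
  have hγsa : IsSemialgebraicFunOn ℚ C (fun x => γ (x 2)) := isSemialgebraicFunOn_read hγ 2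
  have hXsa : IsSemialgebraicFunOn ℚ C Xf := hc₁.fun_add ((hc₂.fun_sub hc₁).fun_mul hx2)
  have hAsa : IsSemialgebraicFunOn ℚ C (fun x => 1 + Xf x * x 0) := hc1.fun_add (hXsa.fun_mul hx0)
  have hBsa : IsSemialgebraicFunOn ℚ C (fun x => Xf x + x 0) := hXsa.fun_add hx0
  have hDsa : IsSemialgebraicFunOn ℚ C (fun x => 1 + (Xf x - 1) * x 0) :=
    hc1.fun_add ((hXsa.fun_sub hc1).fun_mul hx0)
  have hPsa : IsSemialgebraicFunOn ℚ C P := (hBsa.fun_mul hDsa).div (hXsa.fun_mul hAsa) hXAne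
  have hLsa : IsSemialgebraicFunOn ℚ C L :=
    ((hc1.fun_neg.div hAsa hAne).fun_add (hc1.div (hXsa.fun_mul hBsa) hXBne)).fun_add
      ((hXsa.fun_sub hc1).div (hXsa.fun_mul hDsa) hXDne)
  have hP'sa : IsSemialgebraicFunOn ℚ C P' := hPsa.fun_mul (hXsa.fun_mul hLsa)
  have hγtsa : IsSemialgebraicFunOn ℚ C γt := hγsa.div hXsa hXne
  have hEsa : IsSemialgebraicFunOn ℚ C E := hc1.fun_add ((hPsa.fun_sub hc1).fun_mul hx1)
  -- continuity atoms on the cube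
  have hγC : ContinuousOn (fun x : Fin 3 → ℝ => γ (x 2)) C :=
    hγc.comp (continuous_apply 2).continuousOn fun x hx => hmem x hx 2
  have hx1c : ContinuousOn (fun x : Fin 3 → ℝ => x 1) C := (continuous_apply 1).continuousOn
  have hXc : Continuous fun x : Fin 3 → ℝ => x₁ + (x₂ - x₁) * x 2 := by fun_prop
  have hAc : Continuous fun x : Fin 3 → ℝ => 1 + (x₁ + (x₂ - x₁) * x 2) * x 0 := by fun_prop
  have hBc : Continuous fun x : Fin 3 → ℝ => (x₁ + (x₂ - x₁) * x 2) + x 0 := by fun_prop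
  have hDc : Continuous fun x : Fin 3 → ℝ => 1 + ((x₁ + (x₂ - x₁) * x 2) - 1) * x 0 := by fun_prop
  have hPc : ContinuousOn P C := (hBc.mul hDc).continuousOn.div₀ (hXc.mul hAc).continuousOn hXAne
  have hLc : ContinuousOn L C :=
    ((continuousOn_const.div₀ hAc.continuousOn hAne).add
      (continuousOn_const.div₀ (hXc.mul hBc).continuousOn hXBne)).add
      ((hXc.sub continuous_const).continuousOn.div₀ (hXc.mul hDc).continuousOn hXDne)
  have hP'c : ContinuousOn P' C := hPc.fun_mul (hXc.continuousOn.fun_mul hLc)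
  have hγtC : ContinuousOn γt C := hγC.div₀ hXc.continuousOn hXne
  have hEc : ContinuousOn E C := continuousOn_const.fun_add ((hPc.fun_sub continuousOn_const).fun_mul hx1c)
  have hE2c : ContinuousOn (fun x => E x ^ 2) C := hEc.pow 2
  -- the witnesses
  set G0 : (Fin 3 → ℝ) → ℝ := fun x => γt x * (P x - 1) / E x with hG0
  set D0 : (Fin 3 → ℝ) → ℝ := fun x => γt x * P' x / E x ^ 2 with hD0
  set G1 : (Fin 3 → ℝ) → ℝ := fun x => γt x * x 1 * P' x * (1 / P x - 1 / E x) with hG1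
  set D1 : (Fin 3 → ℝ) → ℝ := fun x => γt x * P' x * (1 / P x - 1 / E x ^ 2) with hD1
  -- semialgebraicity
  have hG0sa : IsSemialgebraicFunOn ℚ C G0 := (hγtsa.fun_mul (hPsa.fun_sub hc1)).div hEsa hEne
  have hD0sa : IsSemialgebraicFunOn ℚ C D0 := (hγtsa.fun_mul hP'sa).div (hEsa.fun_pow 2) hE2ne
  have hG1sa : IsSemialgebraicFunOn ℚ C G1 :=
    ((hγtsa.fun_mul hx1).fun_mul hP'sa).fun_mul ((hc1.div hPsa hPne).fun_sub (hc1.div hEsa hEne))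
  have hD1sa : IsSemialgebraicFunOn ℚ C D1 :=
    (hγtsa.fun_mul hP'sa).fun_mul ((hc1.div hPsa hPne).fun_sub (hc1.div (hEsa.fun_pow 2) hE2ne))
  -- continuity on the cube
  have hG0c : ContinuousOn G0 C := (hγtC.fun_mul (hPc.fun_sub continuousOn_const)).div₀ hEc hEne
  have hD0c : ContinuousOn D0 C := (hγtC.fun_mul hP'c).div₀ hE2c hE2ne
  have hG1c : ContinuousOn G1 C :=
    ((hγtC.fun_mul hx1c).fun_mul hP'c).fun_mul
      ((continuousOn_const.div₀ hPc hPne).fun_sub (continuousOn_const.div₀ hEc hEne))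
  have hD1c : ContinuousOn D1 C :=
    (hγtC.fun_mul hP'c).fun_mul ((continuousOn_const.div₀ hPc hPne).fun_sub (continuousOn_const.div₀ hE2c hE2ne))
  -- bounds on the compact cube and continuity along closed fibres
  have hbound : ∀ {F : (Fin 3 → ℝ) → ℝ}, ContinuousOn F C → ∃ B : ℝ, ∀ x ∈ C, |F x| ≤ B := fun hF => by
    obtain ⟨B, hB⟩ := hCc.exists_bound_of_continuousOn hF
    exact ⟨B, fun x hx => by simpa [Real.norm_eq_abs] using hB x hx⟩
  have hcu : ∀ (x : Fin 3 → ℝ) (i : Fin 3), Continuous fun s : ℝ => Function.update x i s :=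
    fun x i => continuous_const.update i continuous_id
  -- all four face values vanish on the cube
  have hG0_one : ∀ x ∈ C, G0 (Function.update x 0 1) = 0 := fun x hx => by
    simp only [hG0, hP01 x hx, sub_self, mul_zero, zero_div]
  have hG0_zero : ∀ x ∈ C, G0 (Function.update x 0 0) = 0 := fun x hx => by
    simp only [hG0, hP00 x hx, sub_self, mul_zero, zero_div]
  have hG1_one : ∀ x, G1 (Function.update x 1 1) = 0 := fun x => by
    simp only [hG1, hE, Function.update_self]
    ring
  have hG1_zero : ∀ x, G1 (Function.update x 1 0) = 0 := fun x => by
    simp only [hG1, Function.update_self, mul_zero, zero_mul]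
  -- derivatives along the fibres: direction `0` for `G0`, direction `1` for `G1`
  have hGder0 : ∀ x ∈ C, HasDerivAt (fun s : ℝ => G0 (Function.update x 0 s)) (D0 x) (x 0) := by
    intro x hx
    have hp := invLoop_hasDerivAt_loop (X := Xf x) (s := x 0) (hXne x hx) (hAne x hx) (hB x hx).ne' (hDne x hx)
    have key := rungCert_hasDerivAt_dir0 (γ := γt x) (y := x 1) hp (hEne x hx)
    refine (key.congr_of_eventuallyEq ?_).congr_deriv rfl
    exact Filter.Eventually.of_forall fun s => by
      have h := hX0 x s
      simp only [hG0, hE, hP, h.1, h.2, Function.update_self, Function.update_of_ne h10]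
  have hGder1 : ∀ x ∈ C, HasDerivAt (fun s : ℝ => G1 (Function.update x 1 s)) (D1 x) (x 1) := by
    intro x hx
    have key := rungCert_hasDerivAt_dir1 (γ := γt x) (a := P' x) (p := P x) (c := P x - 1)
      (s := x 1) (hEne x hx)
    refine (key.congr_of_eventuallyEq ?_).congr_deriv rfl
    exact Filter.Eventually.of_forall fun s => by
      have h := hPL1 x s
      simp only [hG1, hP', hE, h.1, h.2.1, h.2.2.1, h.2.2.2, Function.update_self]
  -- the two closed-cube representations, with integrands `D j` (the face terms vanish)
  obtain ⟨q0, hq0d, hq0i⟩ := exists_cubeRep 3 D0 hD0sa hD0c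
  obtain ⟨q1, hq1d, hq1i⟩ := exists_cubeRep 3 D1 hD1sa hD1c
  -- assemble the two elements
  have hdec : FibStokesDecomposable 3 (fun x => ∑ j, ((![q0, q1] : Fin 2 → IntegralRep 3) j).integrand x) := by
    refine fibStokesDecomposable_of_elements (M := 3) (J := 2) (![0, 1] : Fin 2 → Fin 3)
      (![G0, G1] : Fin 2 → (Fin 3 → ℝ) → ℝ) (![D0, D1] : Fin 2 → (Fin 3 → ℝ) → ℝ)
      (![q0, q1] : Fin 2 → IntegralRep 3) ?_ ?_
    · refine Fin.forall_fin_two.mpr ⟨?_, ?_⟩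
      · -- element 0, along `s = x 0`
        simp only [Matrix.cons_val_zero]
        refine ⟨hG0sa, hD0sa, hbound hG0c, fun x hx => ?_, fun x hx _ => hGder0 x hx⟩
        show ContinuousOn (fun s : ℝ => G0 (Function.update x 0 s)) (Set.Icc (0:ℝ) 1)
        exact hG0c.comp (hcu x 0).continuousOn fun s hs => hupd x hx 0 s hs
      · -- element 1, along `y = x 1`
        simp only [Matrix.cons_val_one, Matrix.cons_val_zero]
        refine ⟨hG1sa, hD1sa, hbound hG1c, fun x hx => ?_, fun x hx _ => hGder1 x hx⟩
        show ContinuousOn (fun s : ℝ => G1 (Function.update x 1 s)) (Set.Icc (0:ℝ) 1)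
        exact hG1c.comp (hcu x 1).continuousOn fun s hs => hupd x hx 1 s hs
    · refine Fin.forall_fin_two.mpr ⟨?_, ?_⟩
      · simp only [Matrix.cons_val_zero]
        exact ⟨hq0d, fun x hx => by rw [hq0i, hG0_one x hx, hG0_zero x hx, sub_zero, sub_zero]⟩
      · simp only [Matrix.cons_val_one, Matrix.cons_val_zero]
        exact ⟨hq1d, fun x _ => by rw [hq1i, hG1_one x, hG1_zero x, sub_zero, sub_zero]⟩
  -- the pointwise identity `D₀ + D₁ = γ̃ P'/P = γ̃ X L = γ L` on the cube
  refine fibStokesDecomposable_congr_off_null 3 _ _ ∅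
    Literature.ModelTheory.ExponentialFields.isSemialgebraic_empty measure_empty (fun x hx _ => ?_) hdec
  show ∑ j, ((![q0, q1] : Fin 2 → IntegralRep 3) j).integrand x = γ (x 2) * L x
  rw [Fin.sum_univ_two]
  simp only [Matrix.cons_val_zero, Matrix.cons_val_one, hq0i, hq1i, hD0, hD1, hP']
  have hxC : x ∈ C := hx
  have h : P x * (Xf x * L x) * (1 / P x) = Xf x * L x := by
    rw [mul_comm (P x) (Xf x * L x), mul_assoc, mul_one_div_cancel (hPne x hxC), mul_one]
  have hγX : γt x * Xf x = γ (x 2) := by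
    simp only [hγt]
    exact div_mul_cancel₀ _ (hXne x hxC)
  linear_combination γt x * h + L x * hγX

end Summit.KontsevichZagierPeriods.KontsevichZagierPeriods.Cruxes.StokesGeneration.FibrewiseStokes

end
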